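import Literature.Probability.Process.StableLikeJumpChainEntropyChain
import Literature.Probability.Process.StableLikeJumpChainRecursion
import HarnessLib

/-!
# Tightness of stable-like chains: the Nash moment bound `E_x(1+‖X_n−x‖)^{α/4} ≤ U n^{1/4}`

Support file for the proof of Bass–Levin 2002, Theorem 1.1
(`Literature.Probability.Process.bassLevin_thm_1_1`). This file carries out the moment step of
Nash's entropy argument in discrete time (two steps at a time) and closes the recursion:

* `am_gm_sqrt` : `a (u − v) ≤ t a² u + t a² v + (√v − √u)²/(2t)`;
* `tsum_swap_*` : the three Tonelli interchanges expressing `M(n)`, `M(n+2)` and the weighted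
  carré du champ through the two-step kernel;
* `moment_step` : `M(n+2) − M(n) ≤ t E_Γ(n) + G_n/(4t)` for every `t > 0`, where
  `M(k) = ∑_z Q k x z (1+‖z−x‖)^β`, `E_Γ(n) = ∑_y Q n x y Γ(y)` and `G_n` is the Hellinger
  Dirichlet form of `√f_n`.

The remaining assembly (summing over dyadic blocks, `le_sqrt_mul_of_forall_pos`, the entropy
bounds and `moment_recursion_bound`) is in `StableLikeJumpChainTightBound`. [folklore]

## References
* J. Nash, *Continuity of solutions of parabolic and elliptic equations*, Amer. J. Math. 80
  (1958) 931–954, Part II.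
* R. F. Bass, D. A. Levin, *Transition probabilities for symmetric jump processes*,
  Trans. Amer. Math. Soc. 354 (2002) 2933–2953, Thm 2.8 (the statement replaced here).
-/

noncomputable section

namespace Literature.Probability.Process

open scoped BigOperators

/-- AM–GM step of the moment estimate: `a (u − v) ≤ t a² u + t a² v + (√v − √u)²/(2t)` for
`u, v ≥ 0`, `t > 0`. [folklore] -/
theorem am_gm_sqrt (a : ℝ) {u v t : ℝ} (hu : 0 ≤ u) (hv : 0 ≤ v) (ht : 0 < t) :
    a * (u - v) ≤ t * a ^ 2 * u + t * a ^ 2 * v + 1 / (2 * t) * (Real.sqrt v - Real.sqrt u) ^ 2 := by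
  set p := Real.sqrt u with hp
  set q := Real.sqrt v with hq
  have hup : u = p ^ 2 := (Real.sq_sqrt hu).symm
  have hvq : v = q ^ 2 := (Real.sq_sqrt hv).symm
  rw [hup, hvq]
  have key : 0 ≤ 2 * t * (t * a ^ 2 * p ^ 2 + t * a ^ 2 * q ^ 2 + 1 / (2 * t) * (q - p) ^ 2 - a * (p ^ 2 - q ^ 2)) := by
    have : 2 * t * (t * a ^ 2 * p ^ 2 + t * a ^ 2 * q ^ 2 + 1 / (2 * t) * (q - p) ^ 2 - a * (p ^ 2 - q ^ 2)) =
        (t * a * (p + q) - (p - q)) ^ 2 + (t * a * (p - q)) ^ 2 := by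
      field_simp
      ring
    rw [this]; positivity
  have h2t : 0 < 2 * t := by linarith
  have := (mul_nonneg_iff_of_pos_left h2t).mp key
  linarith

variable {d : ℕ} {P : (Fin d → ℤ) → (Fin d → ℤ) → ℝ} {Q : ℕ → (Fin d → ℤ) → (Fin d → ℤ) → ℝ}
  {μ : (Fin d → ℤ) → ℝ} {m M c₂ α : ℝ}

/-- The two-step kernel has finite `β`-moments about any point:
`z ↦ Q 2 y z (1+‖z−x‖)^β` is summable. [folklore] -/
theorem summable_kpow_two_mul_weight (hd : 1 ≤ d) (hP0 : ∀ x y, 0 ≤ P x y) (hP1 : ∀ x, HasSum (P x) 1)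
    (hub : ∀ x y, P x y ≤ c₂ * ‖x - y‖ ^ (-((d : ℝ) + α))) (hc₂ : 0 ≤ c₂)
    (hQ0 : ∀ x y, Q 0 x y = if x = y then 1 else 0)
    (hQ : ∀ n x y, Q (n + 1) x y = ∑' z, Q n x z * P z y)
    {β : ℝ} (hβ : 0 < β) (hβ1 : β ≤ 1) (hβα : β < α) (x y : Fin d → ℤ) :
    Summable fun z => Q 2 y z * (1 + ‖z - x‖) ^ β := by
  have hPs : ∀ x, Summable (P x) := fun x => (hP1 x).summable
  have hP1' : ∀ x, ∑' y, P x y ≤ 1 := fun x => ((hP1 x).tsum_eq).le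
  have hQnn : ∀ k x w, 0 ≤ Q k x w := kpow_nonneg hP0 hQ0 hQ
  obtain ⟨hmom, -⟩ := kpow_moment_summable hd hP0 hP1 hub hc₂ hQ0 hQ hβ hβ1 hβα y 2
  have hsub : ∀ z, (1 + ‖z - x‖) ^ β ≤ (1 + ‖z - y‖) ^ β + ‖y - x‖ ^ β := by
    intro z
    have htri : 1 + ‖z - x‖ ≤ (1 + ‖z - y‖) + ‖y - x‖ := by
      have : ‖z - x‖ ≤ ‖z - y‖ + ‖y - x‖ := by
        calc ‖z - x‖ = ‖(z - y) + (y - x)‖ := by congr 1; abel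
          _ ≤ ‖z - y‖ + ‖y - x‖ := norm_add_le _ _
      linarith
    calc (1 + ‖z - x‖) ^ β ≤ ((1 + ‖z - y‖) + ‖y - x‖) ^ β :=
          Real.rpow_le_rpow (by positivity) htri hβ.le
      _ ≤ (1 + ‖z - y‖) ^ β + ‖y - x‖ ^ β :=
          Real.rpow_add_le_add_rpow (by positivity) (norm_nonneg _) hβ.le hβ1
  refine (hmom.add ((kpow_summable hP0 hPs hP1' hQ0 hQ 2 y).mul_right (‖y - x‖ ^ β))).of_nonneg_of_le
    (fun z => mul_nonneg (hQnn 2 y z) (Real.rpow_nonneg (by positivity) _)) (fun z => ?_)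
  calc Q 2 y z * (1 + ‖z - x‖) ^ β ≤ Q 2 y z * ((1 + ‖z - y‖) ^ β + ‖y - x‖ ^ β) :=
        mul_le_mul_of_nonneg_left (hsub z) (hQnn 2 y z)
    _ = Q 2 y z * (1 + ‖z - y‖) ^ β + Q 2 y z * ‖y - x‖ ^ β := by ring

/-- **Tonelli I**: `∑_y ∑_z μ_y Q² y z g(z) f_n(z) = ∑_z Q n x z g(z) = M(n)` for
`g = (1+‖·−x‖)^β`, `f_n = Q n x ·/μ`. [folklore] -/
theorem tsum_swap_weight_density (hd : 1 ≤ d) (hP0 : ∀ x y, 0 ≤ P x y) (hP1 : ∀ x, HasSum (P x) 1)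
    (hμ : ∀ x, m ≤ μ x ∧ μ x ≤ M) (hm : 0 < m)
    (hrev : ∀ x y, μ x * P x y = μ y * P y x)
    (hub : ∀ x y, P x y ≤ c₂ * ‖x - y‖ ^ (-((d : ℝ) + α))) (hc₂ : 0 ≤ c₂)
    (hQ0 : ∀ x y, Q 0 x y = if x = y then 1 else 0)
    (hQ : ∀ n x y, Q (n + 1) x y = ∑' z, Q n x z * P z y)
    {β : ℝ} (hβ : 0 < β) (hβ1 : β ≤ 1) (hβα : β < α) (n : ℕ) (x : Fin d → ℤ) :
    (∀ y, Summable fun z => μ y * Q 2 y z * ((1 + ‖z - x‖) ^ β * (Q n x z / μ z))) ∧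
    (Summable fun y => ∑' z, μ y * Q 2 y z * ((1 + ‖z - x‖) ^ β * (Q n x z / μ z))) ∧
    ∑' y, ∑' z, μ y * Q 2 y z * ((1 + ‖z - x‖) ^ β * (Q n x z / μ z)) =
      ∑' z, Q n x z * (1 + ‖z - x‖) ^ β := by
  have hμnn : ∀ x, 0 ≤ μ x := fun x => hm.le.trans (hμ x).1
  have hμpos : ∀ x, 0 < μ x := fun x => lt_of_lt_of_le hm (hμ x).1
  have hQnn : ∀ k x w, 0 ≤ Q k x w := kpow_nonneg hP0 hQ0 hQ
  have hcol := hasSum_mu_mul_kpow_two hP0 hP1 hrev hQ0 hQ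
  obtain ⟨hmom, -⟩ := kpow_moment_summable hd hP0 hP1 hub hc₂ hQ0 hQ hβ hβ1 hβα x n
  -- the family F z y := μ y * Q 2 y z * (g z * f z), nonnegative
  have hnn : ∀ z y, 0 ≤ μ y * Q 2 y z * ((1 + ‖z - x‖) ^ β * (Q n x z / μ z)) := fun z y =>
    mul_nonneg (mul_nonneg (hμnn y) (hQnn 2 y z))
      (mul_nonneg (Real.rpow_nonneg (by positivity) _) (div_nonneg (hQnn n x z) (hμpos z).le))
  have h1 : ∀ z, Summable fun y => μ y * Q 2 y z * ((1 + ‖z - x‖) ^ β * (Q n x z / μ z)) :=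
    fun z => (hcol z).summable.mul_right _
  have h1sum : ∀ z, ∑' y, μ y * Q 2 y z * ((1 + ‖z - x‖) ^ β * (Q n x z / μ z)) =
      Q n x z * (1 + ‖z - x‖) ^ β := by
    intro z
    rw [tsum_mul_right, (hcol z).tsum_eq]
    have hc : Q n x z / μ z * μ z = Q n x z := div_mul_cancel₀ _ (hμpos z).ne'
    calc μ z * ((1 + ‖z - x‖) ^ β * (Q n x z / μ z)) = (1 + ‖z - x‖) ^ β * (Q n x z / μ z * μ z) := by ring
      _ = (1 + ‖z - x‖) ^ β * Q n x z := by rw [hc]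
      _ = Q n x z * (1 + ‖z - x‖) ^ β := by ring
  have h2 : Summable fun z => ∑' y, μ y * Q 2 y z * ((1 + ‖z - x‖) ^ β * (Q n x z / μ z)) :=
    hmom.congr (fun z => (h1sum z).symm)
  obtain ⟨hsec, hout⟩ := summable_swap_of_nonneg hnn h1 h2
  refine ⟨hsec, hout, ?_⟩
  rw [tsum_swap_of_nonneg hnn h1 h2]
  exact tsum_congr h1sum

/-- **Tonelli II**: `∑_y ∑_z μ_y Q² y z g(z) f_n(y) = ∑_z Q (n+2) x z g(z) = M(n+2)`
(Chapman–Kolmogorov in the `y`-sum). [folklore] -/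
theorem tsum_swap_weight_density' (hd : 1 ≤ d) (hP0 : ∀ x y, 0 ≤ P x y) (hP1 : ∀ x, HasSum (P x) 1)
    (hμ : ∀ x, m ≤ μ x ∧ μ x ≤ M) (hm : 0 < m)
    (hub : ∀ x y, P x y ≤ c₂ * ‖x - y‖ ^ (-((d : ℝ) + α))) (hc₂ : 0 ≤ c₂)
    (hQ0 : ∀ x y, Q 0 x y = if x = y then 1 else 0)
    (hQ : ∀ n x y, Q (n + 1) x y = ∑' z, Q n x z * P z y)
    {β : ℝ} (hβ : 0 < β) (hβ1 : β ≤ 1) (hβα : β < α) (n : ℕ) (x : Fin d → ℤ) :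
    (∀ y, Summable fun z => μ y * Q 2 y z * ((1 + ‖z - x‖) ^ β * (Q n x y / μ y))) ∧
    (Summable fun y => ∑' z, μ y * Q 2 y z * ((1 + ‖z - x‖) ^ β * (Q n x y / μ y))) ∧
    ∑' y, ∑' z, μ y * Q 2 y z * ((1 + ‖z - x‖) ^ β * (Q n x y / μ y)) =
      ∑' z, Q (n + 2) x z * (1 + ‖z - x‖) ^ β := by
  have hPs : ∀ x, Summable (P x) := fun x => (hP1 x).summable
  have hP1' : ∀ x, ∑' y, P x y ≤ 1 := fun x => ((hP1 x).tsum_eq).le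
  have hμnn : ∀ x, 0 ≤ μ x := fun x => hm.le.trans (hμ x).1
  have hμpos : ∀ x, 0 < μ x := fun x => lt_of_lt_of_le hm (hμ x).1
  have hQnn : ∀ k x w, 0 ≤ Q k x w := kpow_nonneg hP0 hQ0 hQ
  obtain ⟨hmom2, -⟩ := kpow_moment_summable hd hP0 hP1 hub hc₂ hQ0 hQ hβ hβ1 hβα x (n + 2)
  -- rewrite the summand: μ y * Q 2 y z * (g z * (Q n x y / μ y)) = Q n x y * Q 2 y z * g z
  have hrw : ∀ y z, μ y * Q 2 y z * ((1 + ‖z - x‖) ^ β * (Q n x y / μ y)) =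
      (Q n x y * Q 2 y z) * (1 + ‖z - x‖) ^ β := by
    intro y z
    have hc : Q n x y / μ y * μ y = Q n x y := div_mul_cancel₀ _ (hμpos y).ne'
    calc μ y * Q 2 y z * ((1 + ‖z - x‖) ^ β * (Q n x y / μ y))
        = Q 2 y z * (1 + ‖z - x‖) ^ β * (Q n x y / μ y * μ y) := by ring
      _ = Q 2 y z * (1 + ‖z - x‖) ^ β * Q n x y := by rw [hc]
      _ = (Q n x y * Q 2 y z) * (1 + ‖z - x‖) ^ β := by ring
  have hnn : ∀ z y, 0 ≤ μ y * Q 2 y z * ((1 + ‖z - x‖) ^ β * (Q n x y / μ y)) := fun z y =>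
    mul_nonneg (mul_nonneg (hμnn y) (hQnn 2 y z))
      (mul_nonneg (Real.rpow_nonneg (by positivity) _) (div_nonneg (hQnn n x y) (hμpos y).le))
  have hCK : ∀ z, HasSum (fun y => Q n x y * Q 2 y z) (Q (n + 2) x z) := by
    intro z
    rw [kpow_add hP0 hPs hP1' hQ0 hQ n 2 x z]
    exact (summable_kpow_mul_kpow hP0 hPs hP1' hQ0 hQ n 2 x z).hasSum
  have h1 : ∀ z, Summable fun y => μ y * Q 2 y z * ((1 + ‖z - x‖) ^ β * (Q n x y / μ y)) := by
    intro z
    exact ((hCK z).summable.mul_right ((1 + ‖z - x‖) ^ β)).congr (fun y => (hrw y z).symm)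
  have h1sum : ∀ z, ∑' y, μ y * Q 2 y z * ((1 + ‖z - x‖) ^ β * (Q n x y / μ y)) =
      Q (n + 2) x z * (1 + ‖z - x‖) ^ β := by
    intro z
    rw [tsum_congr (fun y => hrw y z), tsum_mul_right, (hCK z).tsum_eq]
  have h2 : Summable fun z => ∑' y, μ y * Q 2 y z * ((1 + ‖z - x‖) ^ β * (Q n x y / μ y)) :=
    hmom2.congr (fun z => (h1sum z).symm)
  obtain ⟨hsec, hout⟩ := summable_swap_of_nonneg hnn h1 h2
  refine ⟨hsec, hout, ?_⟩
  rw [tsum_swap_of_nonneg hnn h1 h2]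
  exact tsum_congr h1sum

/-- **Tonelli III**: the weighted carré du champ,
`∑_y ∑_z μ_y Q² y z (g y − g z)² f_n(z) = ∑_z Q n x z Γ(z) = E_Γ(n)`. [folklore] -/
theorem tsum_swap_gamma (hd : 1 ≤ d) (hα : 0 < α) (hα2 : α < 2) (hP0 : ∀ x y, 0 ≤ P x y)
    (hP1 : ∀ x, HasSum (P x) 1)
    (hμ : ∀ x, m ≤ μ x ∧ μ x ≤ M) (hm : 0 < m)
    (hrev : ∀ x y, μ x * P x y = μ y * P y x)
    (hub : ∀ x y, P x y ≤ c₂ * ‖x - y‖ ^ (-((d : ℝ) + α))) (hc₂ : 0 ≤ c₂)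
    (hQ0 : ∀ x y, Q 0 x y = if x = y then 1 else 0)
    (hQ : ∀ n x y, Q (n + 1) x y = ∑' z, Q n x z * P z y)
    {β : ℝ} (hβ : 0 < β) (hβ1 : β ≤ 1) (h2β : 2 * β < α) (n : ℕ) (x : Fin d → ℤ) :
    (∀ y, Summable fun z => Q 2 y z * ((1 + ‖y - x‖) ^ β - (1 + ‖z - x‖) ^ β) ^ 2) ∧
    (Summable fun y => Q n x y * ∑' z, Q 2 y z * ((1 + ‖y - x‖) ^ β - (1 + ‖z - x‖) ^ β) ^ 2) ∧
    (∀ y, Summable fun z => μ y * Q 2 y z *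
      (((1 + ‖y - x‖) ^ β - (1 + ‖z - x‖) ^ β) ^ 2 * (Q n x z / μ z))) ∧
    (Summable fun y => ∑' z, μ y * Q 2 y z *
      (((1 + ‖y - x‖) ^ β - (1 + ‖z - x‖) ^ β) ^ 2 * (Q n x z / μ z))) ∧
    ∑' y, ∑' z, μ y * Q 2 y z * (((1 + ‖y - x‖) ^ β - (1 + ‖z - x‖) ^ β) ^ 2 * (Q n x z / μ z)) =
      ∑' z, Q n x z * ∑' y, Q 2 z y * ((1 + ‖z - x‖) ^ β - (1 + ‖y - x‖) ^ β) ^ 2 := by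
  have hPs : ∀ x, Summable (P x) := fun x => (hP1 x).summable
  have hP1' : ∀ x, ∑' y, P x y ≤ 1 := fun x => ((hP1 x).tsum_eq).le
  have hμnn : ∀ x, 0 ≤ μ x := fun x => hm.le.trans (hμ x).1
  have hμpos : ∀ x, 0 < μ x := fun x => lt_of_lt_of_le hm (hμ x).1
  have hQnn : ∀ k x w, 0 ≤ Q k x w := kpow_nonneg hP0 hQ0 hQ
  obtain ⟨CΓ, hCΓ, hΓ⟩ := gamma_bound hd hα hα2 hP0 hP1 hμ hm hrev hub hc₂ hQ0 hQ hβ hβ1 h2β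
  have hΓs : ∀ y, Summable fun z => Q 2 y z * ((1 + ‖y - x‖) ^ β - (1 + ‖z - x‖) ^ β) ^ 2 :=
    fun y => (hΓ x y).1
  have hΓle : ∀ y, ∑' z, Q 2 y z * ((1 + ‖y - x‖) ^ β - (1 + ‖z - x‖) ^ β) ^ 2 ≤ CΓ := by
    intro y
    refine (hΓ x y).2.trans ?_
    have : (1 + ‖y - x‖) ^ (2 * β - α) ≤ 1 :=
      Real.rpow_le_one_of_one_le_of_nonpos (by linarith [norm_nonneg (y - x)]) (by linarith)
    calc CΓ * (1 + ‖y - x‖) ^ (2 * β - α) ≤ CΓ * 1 := mul_le_mul_of_nonneg_left this hCΓ.le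
      _ = CΓ := mul_one _
  have hEs : Summable fun y => Q n x y * ∑' z, Q 2 y z * ((1 + ‖y - x‖) ^ β - (1 + ‖z - x‖) ^ β) ^ 2 :=
    ((kpow_summable hP0 hPs hP1' hQ0 hQ n x).mul_right CΓ).of_nonneg_of_le
      (fun y => mul_nonneg (hQnn n x y) (tsum_nonneg fun z => mul_nonneg (hQnn 2 y z) (sq_nonneg _)))
      (fun y => mul_le_mul_of_nonneg_left (hΓle y) (hQnn n x y))
  refine ⟨hΓs, hEs, ?_⟩
  -- the family F z y := μ y Q 2 y z (g y - g z)² f z = Q n x z * (Q 2 z y (g z - g y)²)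
  have hrw : ∀ y z, μ y * Q 2 y z * (((1 + ‖y - x‖) ^ β - (1 + ‖z - x‖) ^ β) ^ 2 * (Q n x z / μ z)) =
      Q n x z * (Q 2 z y * ((1 + ‖z - x‖) ^ β - (1 + ‖y - x‖) ^ β) ^ 2) := by
    intro y z
    have hr := kpow_reversible hP0 hPs hP1' hQ0 hQ hrev 2 y z
    have hsq : ((1 + ‖y - x‖) ^ β - (1 + ‖z - x‖) ^ β) ^ 2 = ((1 + ‖z - x‖) ^ β - (1 + ‖y - x‖) ^ β) ^ 2 := by
      ring
    rw [hsq, hr]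
    have hc : μ z * (Q n x z / μ z) = Q n x z := mul_div_cancel₀ _ (hμpos z).ne'
    calc μ z * Q 2 z y * (((1 + ‖z - x‖) ^ β - (1 + ‖y - x‖) ^ β) ^ 2 * (Q n x z / μ z))
        = Q 2 z y * ((1 + ‖z - x‖) ^ β - (1 + ‖y - x‖) ^ β) ^ 2 * (μ z * (Q n x z / μ z)) := by ring
      _ = Q 2 z y * ((1 + ‖z - x‖) ^ β - (1 + ‖y - x‖) ^ β) ^ 2 * Q n x z := by rw [hc]
      _ = Q n x z * (Q 2 z y * ((1 + ‖z - x‖) ^ β - (1 + ‖y - x‖) ^ β) ^ 2) := by ring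
  have hnn : ∀ z y, 0 ≤ μ y * Q 2 y z * (((1 + ‖y - x‖) ^ β - (1 + ‖z - x‖) ^ β) ^ 2 * (Q n x z / μ z)) :=
    fun z y => mul_nonneg (mul_nonneg (hμnn y) (hQnn 2 y z))
      (mul_nonneg (sq_nonneg _) (div_nonneg (hQnn n x z) (hμpos z).le))
  have h1 : ∀ z, Summable fun y => μ y * Q 2 y z *
      (((1 + ‖y - x‖) ^ β - (1 + ‖z - x‖) ^ β) ^ 2 * (Q n x z / μ z)) := by
    intro z
    exact ((hΓs z).mul_left (Q n x z)).congr (fun y => (hrw y z).symm)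
  have h1sum : ∀ z, ∑' y, μ y * Q 2 y z * (((1 + ‖y - x‖) ^ β - (1 + ‖z - x‖) ^ β) ^ 2 * (Q n x z / μ z)) =
      Q n x z * ∑' y, Q 2 z y * ((1 + ‖z - x‖) ^ β - (1 + ‖y - x‖) ^ β) ^ 2 := by
    intro z
    rw [tsum_congr (fun y => hrw y z), tsum_mul_left]
  have h2 : Summable fun z => ∑' y, μ y * Q 2 y z *
      (((1 + ‖y - x‖) ^ β - (1 + ‖z - x‖) ^ β) ^ 2 * (Q n x z / μ z)) :=
    hEs.congr (fun z => (h1sum z).symm)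
  obtain ⟨hsec, hout⟩ := summable_swap_of_nonneg hnn h1 h2
  refine ⟨hsec, hout, ?_⟩
  rw [tsum_swap_of_nonneg hnn h1 h2]
  exact tsum_congr h1sum

/-- **The moment step of Nash's argument (two time steps).** With `g = (1+‖·−x‖)^β`,
`f_n = Q n x · / μ`, `M(k) = ∑_z Q k x z g(z)`, `E_Γ(n) = ∑_y Q n x y Γ(y)` and
`G_n = ∑_y μ_y ∑_z Q² y z (√f_n(y) − √f_n(z))²`, for every `t > 0`:
`M(n+2) − M(n) ≤ t E_Γ(n) + G_n / (4t)`. [folklore] -/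
theorem moment_step (hd : 1 ≤ d) (hα : 0 < α) (hα2 : α < 2) (hP0 : ∀ x y, 0 ≤ P x y)
    (hP1 : ∀ x, HasSum (P x) 1)
    (hμ : ∀ x, m ≤ μ x ∧ μ x ≤ M) (hm : 0 < m)
    (hrev : ∀ x y, μ x * P x y = μ y * P y x)
    (hub : ∀ x y, P x y ≤ c₂ * ‖x - y‖ ^ (-((d : ℝ) + α))) (hc₂ : 0 ≤ c₂)
    (hQ0 : ∀ x y, Q 0 x y = if x = y then 1 else 0)
    (hQ : ∀ n x y, Q (n + 1) x y = ∑' z, Q n x z * P z y)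
    {β : ℝ} (hβ : 0 < β) (hβ1 : β ≤ 1) (h2β : 2 * β < α)
    {ε₀ : ℝ} (hε₀ : 0 < ε₀) (hlazy : ∀ y, ε₀ ≤ Q 2 y y)
    (n : ℕ) (x : Fin d → ℤ) {t : ℝ} (ht : 0 < t) :
    ∑' z, Q (n + 2) x z * (1 + ‖z - x‖) ^ β - ∑' z, Q n x z * (1 + ‖z - x‖) ^ β ≤
      t * ∑' y, Q n x y * ∑' z, Q 2 y z * ((1 + ‖y - x‖) ^ β - (1 + ‖z - x‖) ^ β) ^ 2 +
      1 / (4 * t) * ∑' y, μ y * ∑' z, Q 2 y z *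
        (Real.sqrt (Q n x y / μ y) - Real.sqrt (Q n x z / μ z)) ^ 2 := by
  have hPs : ∀ x, Summable (P x) := fun x => (hP1 x).summable
  have hP1' : ∀ x, ∑' y, P x y ≤ 1 := fun x => ((hP1 x).tsum_eq).le
  have hμnn : ∀ x, 0 ≤ μ x := fun x => hm.le.trans (hμ x).1
  have hμpos : ∀ x, 0 < μ x := fun x => lt_of_lt_of_le hm (hμ x).1
  have hQnn : ∀ k x w, 0 ≤ Q k x w := kpow_nonneg hP0 hQ0 hQ
  have hβα : β < α := by linarith
  -- abbreviations as opaque local functions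
  obtain ⟨g, hg⟩ : ∃ g : (Fin d → ℤ) → ℝ, ∀ z, g z = (1 + ‖z - x‖) ^ β := ⟨_, fun _ => rfl⟩
  obtain ⟨f, hf⟩ : ∃ f : (Fin d → ℤ) → ℝ, ∀ z, f z = Q n x z / μ z := ⟨_, fun _ => rfl⟩
  have hfnn : ∀ z, 0 ≤ f z := fun z => by rw [hf]; exact div_nonneg (hQnn n x z) (hμpos z).le
  have hfB : ∀ z, f z ≤ 1 / m := fun z => by rw [hf]; exact (density_bounds hP0 hP1 hμ hm hQ0 hQ n x z).2.1
  have hμf : ∀ z, μ z * f z = Q n x z := fun z => by rw [hf]; exact mul_div_cancel₀ _ (hμpos z).ne'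
  -- imported facts, restated with g and f
  obtain ⟨hmom, -⟩ := kpow_moment_summable hd hP0 hP1 hub hc₂ hQ0 hQ hβ hβ1 hβα x n
  obtain ⟨hmom2, -⟩ := kpow_moment_summable hd hP0 hP1 hub hc₂ hQ0 hQ hβ hβ1 hβα x (n + 2)
  obtain ⟨hI1, hI2, hIeq⟩ := tsum_swap_weight_density hd hP0 hP1 hμ hm hrev hub hc₂ hQ0 hQ hβ hβ1 hβα n x
  obtain ⟨hII1, hII2, hIIeq⟩ := tsum_swap_weight_density' hd hP0 hP1 hμ hm hub hc₂ hQ0 hQ hβ hβ1 hβα n x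
  obtain ⟨hΓs, hEs, hIII1, hIII2, hIIIeq⟩ :=
    tsum_swap_gamma hd hα hα2 hP0 hP1 hμ hm hrev hub hc₂ hQ0 hQ hβ hβ1 h2β n x
  obtain ⟨hGin, hGout, -⟩ :=
    sqrt_energy_le_dissipation hd hP0 hP1 hμ hm hrev hub hc₂ hα hQ0 hQ hε₀ hlazy n x
  have htwo := fun y => density_two_step hP0 hP1 hμ hm hrev hQ0 hQ n x y
  have hQ2s : ∀ y, Summable (Q 2 y) := fun y => kpow_summable hP0 hPs hP1' hQ0 hQ 2 y
  have hQ21 : ∀ y, ∑' z, Q 2 y z = 1 := fun y => kpow_tsum_eq_one hP0 hP1 hQ0 hQ 2 y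
  have hQ2f : ∀ y, Summable fun z => Q 2 y z * f z := fun y =>
    ((hQ2s y).mul_right (1 / m)).of_nonneg_of_le (fun z => mul_nonneg (hQnn 2 y z) (hfnn z))
      (fun z => mul_le_mul_of_nonneg_left (hfB z) (hQnn 2 y z))
  have hQ2f_sum : ∀ y, ∑' z, Q 2 y z * f z = Q (n + 2) x y / μ y := by
    intro y; rw [htwo y]; exact tsum_congr fun z => by rw [hf]
  -- Step A: the two expressions of ΔM
  -- D₁ y := g y Q(n+2) x y - g y Q n x y = ∑' z, μ y Q 2 y z (g y (f z - f y))
  have hD1 : ∀ y, Q (n + 2) x y * g y - Q n x y * g y = ∑' z, μ y * Q 2 y z * (g y * (f z - f y)) := by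
    intro y
    have h1 : Summable fun z => μ y * Q 2 y z * (g y * f z) :=
      ((hQ2f y).mul_left (μ y * g y)).congr (fun z => by ring)
    have h2 : Summable fun z => μ y * Q 2 y z * (g y * f y) :=
      ((hQ2s y).mul_left (μ y * g y * f y)).congr (fun z => by ring)
    have hsplit : (fun z => μ y * Q 2 y z * (g y * (f z - f y))) =
        fun z => μ y * Q 2 y z * (g y * f z) - μ y * Q 2 y z * (g y * f y) := by funext z; ring
    rw [hsplit, Summable.tsum_sub h1 h2]
    have e1 : ∑' z, μ y * Q 2 y z * (g y * f z) = μ y * g y * ∑' z, Q 2 y z * f z := by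
      rw [← tsum_mul_left]; exact tsum_congr fun z => by ring
    have e2 : ∑' z, μ y * Q 2 y z * (g y * f y) = μ y * g y * f y * ∑' z, Q 2 y z := by
      rw [← tsum_mul_left]; exact tsum_congr fun z => by ring
    rw [e1, e2, hQ2f_sum, hQ21, mul_one]
    have hc : Q (n + 2) x y / μ y * μ y = Q (n + 2) x y := div_mul_cancel₀ _ (hμpos y).ne'
    have : μ y * g y * (Q (n + 2) x y / μ y) = Q (n + 2) x y * g y := by
      calc μ y * g y * (Q (n + 2) x y / μ y) = g y * (Q (n + 2) x y / μ y * μ y) := by ring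
        _ = g y * Q (n + 2) x y := by rw [hc]
        _ = Q (n + 2) x y * g y := by ring
    rw [this, ← hμf y]; ring
  -- D₂ y := ∑' z, μ y Q2 (g z f y) - ∑' z, μ y Q2 (g z f z) = ∑' z, μ y Q 2 y z (g z (f y - f z))
  have hII1' : ∀ y, Summable fun z => μ y * Q 2 y z * (g z * f y) := fun y =>
    (hII1 y).congr (fun z => by rw [hg, hf])
  have hI1' : ∀ y, Summable fun z => μ y * Q 2 y z * (g z * f z) := fun y =>
    (hI1 y).congr (fun z => by rw [hg, hf])
  have hD2 : ∀ y, ∑' z, μ y * Q 2 y z * (g z * f y) - ∑' z, μ y * Q 2 y z * (g z * f z) =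
      ∑' z, μ y * Q 2 y z * (g z * (f y - f z)) := by
    intro y
    rw [← Summable.tsum_sub (hII1' y) (hI1' y)]
    exact tsum_congr fun z => by ring
  -- Step B: pointwise in y, the symmetrised integrand and AM–GM
  have hBy : ∀ y, (Q (n + 2) x y * g y - Q n x y * g y) +
      (∑' z, μ y * Q 2 y z * (g z * f y) - ∑' z, μ y * Q 2 y z * (g z * f z)) ≤
      t * ∑' z, μ y * Q 2 y z * ((g y - g z) ^ 2 * f z) +
      t * (Q n x y * ∑' z, Q 2 y z * (g y - g z) ^ 2) +
      1 / (2 * t) * (μ y * ∑' z, Q 2 y z * (Real.sqrt (f y) - Real.sqrt (f z)) ^ 2) := by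
    intro y
    rw [hD1 y, hD2 y]
    have hS1 : Summable fun z => μ y * Q 2 y z * (g y * (f z - f y)) := by
      have h1 : Summable fun z => μ y * Q 2 y z * (g y * f z) :=
        ((hQ2f y).mul_left (μ y * g y)).congr (fun z => by ring)
      have h2 : Summable fun z => μ y * Q 2 y z * (g y * f y) :=
        ((hQ2s y).mul_left (μ y * g y * f y)).congr (fun z => by ring)
      exact (h1.sub h2).congr (fun z => by ring)
    have hS2 : Summable fun z => μ y * Q 2 y z * (g z * (f y - f z)) :=
      ((hII1' y).sub (hI1' y)).congr (fun z => by ring)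
    rw [← Summable.tsum_add hS1 hS2]
    -- right-hand side summable pieces
    have hR1 : Summable fun z => μ y * Q 2 y z * ((g y - g z) ^ 2 * f z) :=
      (hIII1 y).congr (fun z => by rw [hg, hg, hf])
    have hR2 : Summable fun z => μ y * f y * (Q 2 y z * (g y - g z) ^ 2) :=
      ((hΓs y).mul_left (μ y * f y)).congr (fun z => by rw [hg, hg])
    have hR3 : Summable fun z => μ y * (Q 2 y z * (Real.sqrt (f y) - Real.sqrt (f z)) ^ 2) :=
      ((hGin y).mul_left (μ y)).congr (fun z => by rw [hf, hf])
    have hpt : ∀ z, μ y * Q 2 y z * (g y * (f z - f y)) + μ y * Q 2 y z * (g z * (f y - f z)) ≤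
        t * (μ y * Q 2 y z * ((g y - g z) ^ 2 * f z)) + t * (μ y * f y * (Q 2 y z * (g y - g z) ^ 2)) +
        1 / (2 * t) * (μ y * (Q 2 y z * (Real.sqrt (f y) - Real.sqrt (f z)) ^ 2)) := by
      intro z
      have ham := am_gm_sqrt (g y - g z) (hfnn z) (hfnn y) ht
      have hw : 0 ≤ μ y * Q 2 y z := mul_nonneg (hμnn y) (hQnn 2 y z)
      have := mul_le_mul_of_nonneg_left ham hw
      have e : μ y * Q 2 y z * (g y * (f z - f y)) + μ y * Q 2 y z * (g z * (f y - f z)) =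
          μ y * Q 2 y z * ((g y - g z) * (f z - f y)) := by ring
      rw [e]
      calc μ y * Q 2 y z * ((g y - g z) * (f z - f y))
          ≤ μ y * Q 2 y z * (t * (g y - g z) ^ 2 * f z + t * (g y - g z) ^ 2 * f y +
              1 / (2 * t) * (Real.sqrt (f y) - Real.sqrt (f z)) ^ 2) := this
        _ = _ := by ring
    calc ∑' z, (μ y * Q 2 y z * (g y * (f z - f y)) + μ y * Q 2 y z * (g z * (f y - f z)))
        ≤ ∑' z, (t * (μ y * Q 2 y z * ((g y - g z) ^ 2 * f z)) + t * (μ y * f y * (Q 2 y z * (g y - g z) ^ 2)) +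
            1 / (2 * t) * (μ y * (Q 2 y z * (Real.sqrt (f y) - Real.sqrt (f z)) ^ 2))) :=
          Summable.tsum_le_tsum hpt (hS1.add hS2) (((hR1.mul_left t).add (hR2.mul_left t)).add (hR3.mul_left _))
      _ = t * ∑' z, μ y * Q 2 y z * ((g y - g z) ^ 2 * f z) +
          t * (Q n x y * ∑' z, Q 2 y z * (g y - g z) ^ 2) +
          1 / (2 * t) * (μ y * ∑' z, Q 2 y z * (Real.sqrt (f y) - Real.sqrt (f z)) ^ 2) := by
          rw [Summable.tsum_add ((hR1.mul_left t).add (hR2.mul_left t)) (hR3.mul_left _),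
            Summable.tsum_add (hR1.mul_left t) (hR2.mul_left t), tsum_mul_left, tsum_mul_left, tsum_mul_left,
            tsum_mul_left, tsum_mul_left, hμf y]
  -- Step C: sum over y
  have hLs : Summable fun y => (Q (n + 2) x y * g y - Q n x y * g y) +
      (∑' z, μ y * Q 2 y z * (g z * f y) - ∑' z, μ y * Q 2 y z * (g z * f z)) := by
    have h1 : Summable fun y => Q (n + 2) x y * g y := hmom2.congr (fun y => by rw [hg])
    have h2 : Summable fun y => Q n x y * g y := hmom.congr (fun y => by rw [hg])
    have h3 : Summable fun y => ∑' z, μ y * Q 2 y z * (g z * f y) :=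
      hII2.congr (fun y => tsum_congr fun z => by rw [hg, hf])
    have h4 : Summable fun y => ∑' z, μ y * Q 2 y z * (g z * f z) :=
      hI2.congr (fun y => tsum_congr fun z => by rw [hg, hf])
    exact (h1.sub h2).add (h3.sub h4)
  have hRs1 : Summable fun y => ∑' z, μ y * Q 2 y z * ((g y - g z) ^ 2 * f z) :=
    hIII2.congr (fun y => tsum_congr fun z => by rw [hg, hg, hf])
  have hRs2 : Summable fun y => Q n x y * ∑' z, Q 2 y z * (g y - g z) ^ 2 :=
    hEs.congr (fun y => by congr 1; exact tsum_congr fun z => by rw [hg, hg])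
  have hRs3 : Summable fun y => μ y * ∑' z, Q 2 y z * (Real.sqrt (f y) - Real.sqrt (f z)) ^ 2 :=
    hGout.congr (fun y => by congr 1; exact tsum_congr fun z => by rw [hf, hf])
  have hRs : Summable fun y => t * ∑' z, μ y * Q 2 y z * ((g y - g z) ^ 2 * f z) +
      t * (Q n x y * ∑' z, Q 2 y z * (g y - g z) ^ 2) +
      1 / (2 * t) * (μ y * ∑' z, Q 2 y z * (Real.sqrt (f y) - Real.sqrt (f z)) ^ 2) :=
    ((hRs1.mul_left t).add (hRs2.mul_left t)).add (hRs3.mul_left _)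
  have hsumC := Summable.tsum_le_tsum hBy hLs hRs
  -- evaluate both sides
  have hLval : ∑' y, ((Q (n + 2) x y * g y - Q n x y * g y) +
      (∑' z, μ y * Q 2 y z * (g z * f y) - ∑' z, μ y * Q 2 y z * (g z * f z))) =
      2 * (∑' z, Q (n + 2) x z * (1 + ‖z - x‖) ^ β - ∑' z, Q n x z * (1 + ‖z - x‖) ^ β) := by
    have h1 : Summable fun y => Q (n + 2) x y * g y := hmom2.congr (fun y => by rw [hg])
    have h2 : Summable fun y => Q n x y * g y := hmom.congr (fun y => by rw [hg])
    have h3 : Summable fun y => ∑' z, μ y * Q 2 y z * (g z * f y) :=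
      hII2.congr (fun y => tsum_congr fun z => by rw [hg, hf])
    have h4 : Summable fun y => ∑' z, μ y * Q 2 y z * (g z * f z) :=
      hI2.congr (fun y => tsum_congr fun z => by rw [hg, hf])
    rw [Summable.tsum_add (h1.sub h2) (h3.sub h4), Summable.tsum_sub h1 h2, Summable.tsum_sub h3 h4]
    have e1 : ∑' y, Q (n + 2) x y * g y = ∑' z, Q (n + 2) x z * (1 + ‖z - x‖) ^ β :=
      tsum_congr fun y => by rw [hg]
    have e2 : ∑' y, Q n x y * g y = ∑' z, Q n x z * (1 + ‖z - x‖) ^ β := tsum_congr fun y => by rw [hg]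
    have e3 : ∑' y, ∑' z, μ y * Q 2 y z * (g z * f y) = ∑' z, Q (n + 2) x z * (1 + ‖z - x‖) ^ β := by
      rw [← hIIeq]; exact tsum_congr fun y => tsum_congr fun z => by rw [hg, hf]
    have e4 : ∑' y, ∑' z, μ y * Q 2 y z * (g z * f z) = ∑' z, Q n x z * (1 + ‖z - x‖) ^ β := by
      rw [← hIeq]; exact tsum_congr fun y => tsum_congr fun z => by rw [hg, hf]
    rw [e1, e2, e3, e4]; ring
  have hRval : ∑' y, (t * ∑' z, μ y * Q 2 y z * ((g y - g z) ^ 2 * f z) +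
      t * (Q n x y * ∑' z, Q 2 y z * (g y - g z) ^ 2) +
      1 / (2 * t) * (μ y * ∑' z, Q 2 y z * (Real.sqrt (f y) - Real.sqrt (f z)) ^ 2)) =
      t * ∑' y, Q n x y * ∑' z, Q 2 y z * ((1 + ‖y - x‖) ^ β - (1 + ‖z - x‖) ^ β) ^ 2 +
      t * ∑' y, Q n x y * ∑' z, Q 2 y z * ((1 + ‖y - x‖) ^ β - (1 + ‖z - x‖) ^ β) ^ 2 +
      1 / (2 * t) * ∑' y, μ y * ∑' z, Q 2 y z *
        (Real.sqrt (Q n x y / μ y) - Real.sqrt (Q n x z / μ z)) ^ 2 := by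
    rw [Summable.tsum_add ((hRs1.mul_left t).add (hRs2.mul_left t)) (hRs3.mul_left _),
      Summable.tsum_add (hRs1.mul_left t) (hRs2.mul_left t), tsum_mul_left, tsum_mul_left, tsum_mul_left]
    have e1 : ∑' y, ∑' z, μ y * Q 2 y z * ((g y - g z) ^ 2 * f z) =
        ∑' y, Q n x y * ∑' z, Q 2 y z * ((1 + ‖y - x‖) ^ β - (1 + ‖z - x‖) ^ β) ^ 2 := by
      rw [show (∑' y, Q n x y * ∑' z, Q 2 y z * ((1 + ‖y - x‖) ^ β - (1 + ‖z - x‖) ^ β) ^ 2) =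
          ∑' z, Q n x z * ∑' y, Q 2 z y * ((1 + ‖z - x‖) ^ β - (1 + ‖y - x‖) ^ β) ^ 2 from rfl, ← hIIIeq]
      exact tsum_congr fun y => tsum_congr fun z => by rw [hg, hg, hf]
    have e2 : ∑' y, Q n x y * ∑' z, Q 2 y z * (g y - g z) ^ 2 =
        ∑' y, Q n x y * ∑' z, Q 2 y z * ((1 + ‖y - x‖) ^ β - (1 + ‖z - x‖) ^ β) ^ 2 :=
      tsum_congr fun y => by congr 1; exact tsum_congr fun z => by rw [hg, hg]
    have e3 : ∑' y, μ y * ∑' z, Q 2 y z * (Real.sqrt (f y) - Real.sqrt (f z)) ^ 2 =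
        ∑' y, μ y * ∑' z, Q 2 y z * (Real.sqrt (Q n x y / μ y) - Real.sqrt (Q n x z / μ z)) ^ 2 :=
      tsum_congr fun y => by congr 1; exact tsum_congr fun z => by rw [hf, hf]
    rw [e1, e2, e3]
  rw [hLval, hRval] at hsumC
  -- Step D: divide by 2
  have hG0 : 0 ≤ ∑' y, μ y * ∑' z, Q 2 y z * (Real.sqrt (Q n x y / μ y) - Real.sqrt (Q n x z / μ z)) ^ 2 :=
    tsum_nonneg fun y => mul_nonneg (hμnn y) (tsum_nonneg fun z => mul_nonneg (hQnn 2 y z) (sq_nonneg _))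
  have h4t : 1 / (4 * t) * ∑' y, μ y * ∑' z, Q 2 y z * (Real.sqrt (Q n x y / μ y) - Real.sqrt (Q n x z / μ z)) ^ 2 =
      (1 / (2 * t) * ∑' y, μ y * ∑' z, Q 2 y z * (Real.sqrt (Q n x y / μ y) - Real.sqrt (Q n x z / μ z)) ^ 2) / 2 := by
    field_simp
    ring
  rw [h4t]
  linarith

end Literature.Probability.Process
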